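import Literature.MathematicalPhysics.QuantumFieldTheory.Balaban1983to89.B9Eq326G1kSliceGradRowClosed
import Literature.MathematicalPhysics.QuantumFieldTheory.Balaban1983to89.B9Eq347GlobalFromLocal

/-!
# `Balaban1983to89.B9Eq347G1kSupGradGlobal` — T. Bałaban, *Propagators for lattice gauge theories in a background field*, Commun. Math. Phys. **99** (1985)
# 389–434 [Balaban1985BackgroundPropagators] Thm 3.1 (3.47) p. 398 *«|G′(U)λ|_{(2+γ)}, … ≤ B₀|λ|_{(γ)}»* with p. 398 l. 19–20 *«the global inequalities (3.47) are
# consequences of the local ones (3.42) and Lemma 2.1»*, Thm 3.3 p. 399 (*«with G′(U) replaced by G(U)»*), Thm 3.13 p. 426, and [Balaban1985Variational] (117)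
# p. 295 *«By Theorem 3.13 of [5] the norm max{|·|_{(−1)}, |∇·|_{(−2)}} of the transformation can be estimated by B₀|J|_{(−3)} + …»*: **THE GLOBAL SUP → SUP
# BOUNDS OF THE TOWER BOND PROPAGATOR AND OF ITS COVARIANT GRADIENT, WITH ONE HEIGHT-FREE CONSTANT — `∃ α₁ B` BEFORE `∀ n η c₀ c₁ m U`: for EVERY bond field `f`
# with `‖f‖_∞ ≤ M`, every component `μ`, every bond `b`: `‖(G₁,kf)(b)‖ ≤ B·M`, `‖(D_U(G₁,kf)_μ)(b)‖ ≤ B·M`, `‖(∇_UG₁,kf)(b, μ)‖ ≤ B·M`** — the two entries of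
# (3.42) for `G₁,k` in their `∃`-first local forms (ne9-leaf-05's (K64) `exists_local_letter_G1k`, this lineage's (E2) `exists_local_gradLetter_G1k`) summed over
# the source blocks by ne9-leaf-03's (G) `B9Eq347GlobalFromLocal.norm_apply_le_of_local` with the VOLUME-FREE row constant `K_d(δ)` of `B4Sect5Torus.torusSum_le`:
# at the tower's top level (`L^jη = 1`, one weight) this IS the pair of `L^∞ → L^∞` letters the space (115)'s norm `max{|·|_{(−1)}, |∇·|_{(−2)}}` asks of `G₁`
# in (117) (`B11Eq115KernelOp.mkJetCLM`: ONE constant for the max of the value and the derivative component); NE9 owner INTENT-7 gen 96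

statement-level skeleton of published theorems with citation tags; proofs where landed; nothing here is a claim about the Yang–Mills mass gap

CITATION HEADER (lean-in-tree rule).  Audit cell `pub-balaban`, sub-cell `t4`, BINDER row NE9; filed by the NE9 BINDER-row OWNER lineage `b2b-balaban-t4-ne9-p1` (gen 96).
Imports this lineage's (E2) `B9Eq326G1kSliceGradRowClosed` (through it (K64)) and ne9-leaf-03's (G) `B9Eq347GlobalFromLocal`.  SOURCE READ first-hand in the held text
layer [Balaban1985BackgroundPropagators] (`paper:balaban1985-cmp99-background-propagators`): p. 397 (3.39)–(3.42); p. 398 (3.47) and l. 17–20; p. 399 Thm 3.3;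
p. 426 Thm 3.13; [Balaban1985Variational] p. 294 (115), p. 295 (117); [Balaban1984PropagatorsII] p. 234 Lemma 2.1 (2.61) through (G)'s audited header.  Print's
multi-level weights `(L^jη)^{−α}` ((3.41)) are NOT reproduced — the cell's tower has ONE level on top (`a ≡ 1`, `ω ≡ 1` in (G)'s letters); [folklore] summation BY
NAME; nothing printed is a hypothesis except the model letters.

WHAT IS PROVED (sorry-free; proof lane — 0 `def`; [folklore]).  **`exists_global_supGrad_G1k`** — `∃ α₁ B, 0 < α₁ ∧ 0 ≤ B ∧ ∀ ⟨(K64)'s binder block VERBATIM up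
to `hpos`⟩ (f : BondL2K) (M) (0 ≤ M) (‖f(b)‖ ≤ M) (μ) (b), ‖(G₁,kf)(b)‖ ≤ B·M ∧ ‖(D_U(G₁,kf)_μ)(b)‖ ≤ B·M ∧ ‖(∇_UG₁,kf)(b, μ)‖ ≤ B·M`: (K64) gives `(α_V, B_V, δ_V)`,
(E2) gives `(α_D, B_D, δ_D)`; `α₁ := min α_V α_D`, `B := B_V·K_d(δ_V) + B_D·K_d(δ_D)`; each local letter is read on the plain bond functions (`WL2.equiv` is the
identity) and summed by (G) `norm_apply_le_of_local` (`π := Π∘bpos`; output `π′ := Π∘bpos` for the value, `Π∘btgt` for the gradient) with `torusSum_le`; the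
`covGrad` member by (VGT-a) `norm_covGrad_apply_le_of_slice`.
HONEST SCOPE.  Summation BY NAME; `B` symbolic and crude; ONE weight (the top level) — print's (3.47) across levels with the weights (3.41) is NOT here; the MODEL
letters, `hRlev`, `hpos′`∕`hpos` stay DISPLAYED exactly as in (K64)∕(E2); the (117) bound proper (composition with `𝔓_k*`, the row-sum∕jet reading
`B11Eq115KernelOp.mkJetCLM`, `H₁,k`) is NOT here; nothing of [B9] Thm 3.1∕3.3∕3.11∕3.13 is asserted, valued or discharged.  NOT NE9 (cell pub-balaban: NE9 NOT PRINTED ∕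
NOT PROVED; «NE9 ⇐ the named binders»; row WALLED ON A MODEL (O-NE9-1; #5 UNRULED); spine PROVED 0∕9; rung (B)+1 on a finite T⁴ — NOT infinite volume, NOT mass gap,
NOT BetaPertH, NOT Clay; HONEST DEPENDENCY: continuum YM on T⁴ ⇐ BetaPertH ∧ nine spine estimates (0/9 proved); BetaPertH ⇐ (D1) ∧ (D4) ∧ CAP+tail; G-an2-4 gates
asym, D1 and NE2/3/4).  NEW file; nothing modified.  Net new unproved facts: 0.
-/

noncomputable section

set_option autoImplicit false

open scoped InnerProductSpace ComplexConjugate BigOperators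

namespace Literature.MathematicalPhysics.QuantumFieldTheory.Balaban1983to89.B9Eq347G1kSupGradGlobal

open B4Sect5Torus (TSite tdist torusSum_le)
open B4Sect5Proof (latticeConst latticeConst_nonneg)
open B9SectCLatticeCarrier (Bond bpos btgt unshift)
open B9Eq311L2Pairing (WL2)
open B9Eq33CovDerivVector (covGrad)
open B9Eq319QprimeTorus (fineP blockCoord)
open B7Prop1Explicit (U1 Wcx boxVec)
open B11Eq103H1Complex (SiteL2K BondL2K covDerivL2K)
open B9Eq310DeltaPrime (plaqHolU)
open B9Eq310HessianOperator (adTransportW)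
open B9Eq315QTorus (perCfg cornerSite)
open B9Eq315QTower (towerP UlevOf)
open B9Eq316TowerFlatIsOneStep (towerP_eq_fineP_pow siteCast)
open B9Eq326OperatorTower (QkW laplaceAk G1k)
open B9Eq324DeltaPrimeATower (laplacePrimeAk)
open B9Eq326G1kSupRowClosed (exists_local_letter_G1k)
open B9Eq326G1kSliceGradRowClosed (exists_local_gradLetter_G1k)
open B9Eq347GlobalFromLocal (norm_apply_le_of_local)
open B9Eq326LocalPartTowerSliceGradientRow (norm_covGrad_apply_le_of_slice)

variable {d : ℕ} (hd : 1 ≤ d) (L : ℕ) [NeZero L] (hL : 1 ≤ L) (hL3 : 3 ≤ L)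
  {𝔸 : Type*} [NormedRing 𝔸] [NormedAlgebra ℂ 𝔸] [CompleteSpace 𝔸] [NormOneClass 𝔸] [StarRing 𝔸] [NormedStarGroup 𝔸] [StarModule ℂ 𝔸]
  {W : Type*} [NormedAddCommGroup W] [InnerProductSpace ℂ W] [FiniteDimensional ℂ W] (φ : W ≃ₗ[ℂ] 𝔸)
  {Mφ Mφ' : ℝ} (hMφ : 0 ≤ Mφ) (hMφ' : 0 ≤ Mφ') (hφ : ∀ w, ‖φ w‖ ≤ Mφ * ‖w‖) (hφ' : ∀ X, ‖φ.symm X‖ ≤ Mφ' * ‖X‖) (hstar : ∀ X : 𝔸, ‖star X‖ ≤ ‖X‖)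
  {a : ℝ} (ha : 0 < a) {a' : ℝ} (ha' : 0 < a') {ϱ : ℝ} (hϱ0 : 0 ≤ ϱ) (hϱ1 : ϱ < 1)
  (τ : 𝔸 →ₗ[ℂ] ℂ) {Cτ : ℝ} (hτ : ∀ X, ‖τ X‖ ≤ Cτ * ‖X‖) (hCτ : 0 ≤ Cτ) {Mτ : ℝ} (hτm : ∀ X Y : 𝔸, ‖τ (X * Y)‖ ≤ Mτ * ‖X‖ * ‖Y‖) (hMτ : 0 ≤ Mτ)
  {ρw : ℝ} (hρw : 0 ≤ ρw)
  (hτ₁ : ∀ X : 𝔸, τ (star X) = conj (τ X)) (hτ₂ : ∀ X Y : 𝔸, τ (X * Y) = τ (Y * X)) (hφτ : ∀ X Y : 𝔸, ⟪φ.symm X, φ.symm Y⟫_ℂ = τ (star X * Y))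
  (AQ : ℝ)

set_option maxHeartbeats 400000 in -- (K64)'s ≈ 45 binders twice (value + gradient suppliers): the final defeq assembly exceeds the default budget
include hd hL hL3 hMφ hMφ' hφ hφ' hstar ha ha' hϱ0 hϱ1 hτ hCτ hτm hMτ hρw hτ₁ hτ₂ hφτ in
/-- **THE GLOBAL SUP → SUP BOUNDS OF `G₁,k` AND `∇_UG₁,k`, ONE HEIGHT-FREE CONSTANT** ((3.47) from (3.42) *«and Lemma 2.1»* for print's `G` at the tower's top
level; the two `L^∞ → L^∞` letters (117) asks of `G₁`).  For every height, spacing on the diagonal, period, background of the MODEL letters in one window `α ≤ α₁`,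
ANY positivity witnesses, EVERY bond field `f` with `‖f‖_∞ ≤ M`, every component `μ` and bond `b`: `‖(G₁,kf)(b)‖ ≤ B·M`, `‖(D_U(G₁,kf)_μ)(b)‖ ≤ B·M`,
`‖(∇_UG₁,kf)(b, μ)‖ ≤ B·M`. [cite: Balaban1985BackgroundPropagators, Thm 3.1 (3.47) p.398, (3.42) p.397, Thm 3.3 p.399, Thm 3.13 p.426; Balaban1985Variational, (115) p.294,
(117) p.295] [cite: Balaban1984PropagatorsII, Lemma 2.1 (2.61) p.234] -/
theorem exists_global_supGrad_G1k :
    ∃ α₁ B : ℝ, 0 < α₁ ∧ 0 ≤ B ∧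
      ∀ (n : ℕ) (η : ℝ) (_hηL : η * (L : ℝ) ^ (n + 1) = 1) (c₀ c₁ : ℝ) [Fact (0 < c₀)] [Fact (0 < c₁)]
        (_hw : c₀ * ((L : ℝ) ^ (n + 1)) ^ d = c₁) (_hρ : |η| ^ d / c₀ ≤ ρw) (m : Fin d → ℕ) [∀ i, NeZero (m i)] (_hm : ∀ i, 1 ≤ m i)
        (U : Bond d (towerP L m (n + 1)) → 𝔸ˣ) (αU : ℕ → ℝ) (_hα0 : ∀ j, 0 ≤ αU j) (hα1 : ∀ j, αU j ≤ 1 / 64)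
        (hU1 : ∀ (j : ℕ) (x : B7Prop1Explicit.Site d) (k : Fin d), perCfg (towerP L m (j + 1)) (UlevOf L m (n + 1) U j) x k ∈ U1 𝔸)
        (hreg : ∀ (j : ℕ) (y : TSite d (towerP L m j)) (k : Fin d) (ρ' : Fin d → Fin L),
          ‖((Wcx L (perCfg (towerP L m (j + 1)) (UlevOf L m (n + 1) U j)) (cornerSite L y) k (boxVec L ρ') : 𝔸ˣ) : 𝔸) - 1‖ ≤ αU j)
        (εU : ℕ → ℝ) (_hεU : ∀ j, 0 ≤ εU j) (_hUε : ∀ (j : ℕ) (b : Bond d (towerP L m (j + 1))), ‖(UlevOf L m (n + 1) U j b : 𝔸) - 1‖ ≤ εU j)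
        (_hLb : ∀ (j : ℕ) (b : Bond d (towerP L m (j + 1))), UlevOf L m (n + 1) U j b ∈ U1 𝔸)
        (α : ℝ) (_hα : 0 ≤ α) (_hαle : α ≤ α₁)
        (hUst : ∀ b, star (U b : 𝔸) = (((U b)⁻¹ : 𝔸ˣ) : 𝔸)) (_hUb : ∀ b, U b ∈ U1 𝔸) (_hUη : ∀ b, ‖(U b : 𝔸) - 1‖ ≤ α * η)
        (_hpl : ∀ p : B9SectCLatticeCarrier.Plaq d (towerP L m (n + 1)), ‖(plaqHolU U p : 𝔸) - 1‖ ≤ α * η ^ 2)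
        (_hUgrad : ∀ (x : TSite d (towerP L m (n + 1))) (μ : Fin d), ‖(U (x, μ) : 𝔸) - U (unshift μ x, μ)‖ ≤ α * η ^ 2)
        (_hRlev : ∀ (j : ℕ) (b : Bond d (towerP L m (j + 1))) (w : W), ‖adTransportW φ (UlevOf L m (n + 1) U j) b w‖ ≤ ‖w‖)
        (_hεg : ∀ j < n + 1, εU j ≤ α * ϱ ^ j) (_hAQ : ∑ j ∈ Finset.range (n + 1), αU j ≤ AQ)
        (hpos' : ∀ x : SiteL2K ℂ d (towerP L m (n + 1)) c₀ W, x ≠ 0 → 0 < RCLike.re ⟪x, laplacePrimeAk L m n φ η U a' (c₁ := c₁) x⟫_ℂ)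
        (hpos : ∀ x : BondL2K ℂ d (towerP L m (n + 1)) c₀ W, x ≠ 0 →
          0 < RCLike.re ⟪x, laplaceAk L m n φ η U hL αU hα1 hU1 hreg τ (c₀ := c₀) (c₁ := c₁) a x⟫_ℂ)
        (f : BondL2K ℂ d (towerP L m (n + 1)) c₀ W) (M : ℝ) (_hM : 0 ≤ M) (_hfM : ∀ b, ‖WL2.equiv ℂ (fun _ : Bond d (towerP L m (n + 1)) => c₀) W f b‖ ≤ M) (μ : Fin d) (b : Bond d (towerP L m (n + 1))),
        ‖WL2.equiv ℂ (fun _ : Bond d (towerP L m (n + 1)) => c₀) W (G1k L m n φ η U hL αU hα1 hU1 hreg τ (c₀ := c₀) (c₁ := c₁) hpos f) b‖ ≤ B * M ∧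
          ‖WL2.equiv ℂ (fun _ : Bond d (towerP L m (n + 1)) => c₀) W (covDerivL2K ℂ c₀ ((η : ℂ))⁻¹ (adTransportW φ U) ((WL2.equiv ℂ (fun _ : TSite d (towerP L m (n + 1)) => c₀) W).symm fun y => WL2.equiv ℂ (fun _ : Bond d (towerP L m (n + 1)) => c₀) W (G1k L m n φ η U hL αU hα1 hU1 hreg τ (c₀ := c₀) (c₁ := c₁) hpos f) (y, μ))) b‖ ≤ B * M ∧
          ‖covGrad ((η : ℂ))⁻¹ (adTransportW φ U) (WL2.equiv ℂ (fun _ : Bond d (towerP L m (n + 1)) => c₀) W (G1k L m n φ η U hL αU hα1 hU1 hreg τ (c₀ := c₀) (c₁ := c₁) hpos f)) (b, μ)‖ ≤ B * M := by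
  classical
  obtain ⟨αV, BV, δV, hαV, hBV, hδV, HV⟩ := exists_local_letter_G1k hd L hL hL3 φ hMφ hMφ' hφ hφ' hstar ha ha' hϱ0 hϱ1 τ hτ hCτ hτm hMτ hρw hτ₁ hτ₂ hφτ AQ
  obtain ⟨αD, BD, δD, hαD, hBD, hδD, HD⟩ := exists_local_gradLetter_G1k hd L hL hL3 φ hMφ hMφ' hφ hφ' hstar ha ha' hϱ0 hϱ1 τ hτ hCτ hτm hMτ hρw hτ₁ hτ₂ hφτ AQ
  have hKV : 0 ≤ latticeConst d δV := latticeConst_nonneg d hδV.le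
  have hKD : 0 ≤ latticeConst d δD := latticeConst_nonneg d hδD.le
  refine ⟨min αV αD, BV * latticeConst d δV + BD * latticeConst d δD, lt_min hαV hαD, by positivity, ?_⟩
  intro n η hηL c₀ c₁ _ _ hw hρ m _ hm U αU hα0 hα1 hU1 hreg εU hεU hUε hLb α hα hαle hUst hUb hUη hpl hUgrad hRlev hεg hAQ hpos' hpos f M hM0 hfM μ b
  have hαV' : α ≤ αV := hαle.trans (min_le_left _ _)
  have hαD' : α ≤ αD := hαle.trans (min_le_right _ _)
  -- the two propagator maps read on the plain bond functions
  obtain ⟨TV, hTV⟩ : ∃ T : (Bond d (towerP L m (n + 1)) → W) →ₗ[ℂ] (Bond d (towerP L m (n + 1)) → W),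
      ∀ g x, T g x = WL2.equiv ℂ (fun _ : Bond d (towerP L m (n + 1)) => c₀) W ((G1k L m n φ η U hL αU hα1 hU1 hreg τ (c₀ := c₀) (c₁ := c₁) hpos) (((WL2.equiv ℂ (fun _ : Bond d (towerP L m (n + 1)) => c₀) W)).symm g)) x :=
    ⟨(WL2.linearEquiv ℂ ℂ (fun _ : Bond d (towerP L m (n + 1)) => c₀)).toLinearMap ∘ₗ (G1k L m n φ η U hL αU hα1 hU1 hreg τ (c₀ := c₀) (c₁ := c₁) hpos) ∘ₗ
      (WL2.linearEquiv ℂ ℂ (fun _ : Bond d (towerP L m (n + 1)) => c₀)).symm.toLinearMap, fun _ _ => rfl⟩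
  obtain ⟨TD, hTD⟩ : ∃ T : (Bond d (towerP L m (n + 1)) → W) →ₗ[ℂ] (Bond d (towerP L m (n + 1)) → W),
      ∀ g x, T g x = WL2.equiv ℂ (fun _ : Bond d (towerP L m (n + 1)) => c₀) W (covDerivL2K ℂ c₀ ((η : ℂ))⁻¹ (adTransportW φ U)
        ((WL2.equiv ℂ (fun _ : TSite d (towerP L m (n + 1)) => c₀) W).symm fun y => WL2.equiv ℂ (fun _ : Bond d (towerP L m (n + 1)) => c₀) W ((G1k L m n φ η U hL αU hα1 hU1 hreg τ (c₀ := c₀) (c₁ := c₁) hpos) (((WL2.equiv ℂ (fun _ : Bond d (towerP L m (n + 1)) => c₀) W)).symm g)) (y, μ))) x :=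
    ⟨(WL2.linearEquiv ℂ ℂ (fun _ : Bond d (towerP L m (n + 1)) => c₀)).toLinearMap ∘ₗ
      (covDerivL2K ℂ c₀ ((η : ℂ))⁻¹ (adTransportW φ U) ∘ₗ
        (WL2.linearEquiv ℂ ℂ (fun _ : TSite d (towerP L m (n + 1)) => c₀)).symm.toLinearMap ∘ₗ
        LinearMap.funLeft ℂ W (fun y : TSite d (towerP L m (n + 1)) => ((y, μ) : Bond d (towerP L m (n + 1)))) ∘ₗ
        (WL2.linearEquiv ℂ ℂ (fun _ : Bond d (towerP L m (n + 1)) => c₀)).toLinearMap) ∘ₗ (G1k L m n φ η U hL αU hα1 hU1 hreg τ (c₀ := c₀) (c₁ := c₁) hpos) ∘ₗ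
      (WL2.linearEquiv ℂ ℂ (fun _ : Bond d (towerP L m (n + 1)) => c₀)).symm.toLinearMap, fun _ _ => rfl⟩
  -- their local letters
  have hlocV : ∀ (v : TSite d m) (g : Bond d (towerP L m (n + 1)) → W) (F : ℝ), (∀ y, blockCoord (L ^ (n + 1)) m (siteCast (towerP_eq_fineP_pow L m (n + 1)) (bpos y)) ≠ v → g y = 0) → (∀ y, ‖g y‖ ≤ F) →
      ∀ x, ‖TV g x‖ ≤ BV * Real.exp (-(δV * tdist m (blockCoord (L ^ (n + 1)) m (siteCast (towerP_eq_fineP_pow L m (n + 1)) (bpos x))) v)) * F := by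
    intro v g F hgv hgF x
    rw [hTV]
    exact HV n η hηL c₀ c₁ hw hρ m hm U αU hα0 hα1 hU1 hreg εU hεU hUε hLb α hα hαV' hUst hUb hUη hpl hUgrad hRlev hεg hAQ hpos' hpos v
      (((WL2.equiv ℂ (fun _ : Bond d (towerP L m (n + 1)) => c₀) W)).symm g) F (fun y hy => by rw [Equiv.apply_symm_apply]; exact hgv y hy) (fun y => by rw [Equiv.apply_symm_apply]; exact hgF y) x
  have hlocD : ∀ (v : TSite d m) (g : Bond d (towerP L m (n + 1)) → W) (F : ℝ), (∀ y, blockCoord (L ^ (n + 1)) m (siteCast (towerP_eq_fineP_pow L m (n + 1)) (bpos y)) ≠ v → g y = 0) → (∀ y, ‖g y‖ ≤ F) →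
      ∀ x, ‖TD g x‖ ≤ BD * Real.exp (-(δD * tdist m (blockCoord (L ^ (n + 1)) m (siteCast (towerP_eq_fineP_pow L m (n + 1)) (btgt x))) v)) * F := by
    intro v g F hgv hgF x
    rw [hTD]
    exact (HD n η hηL c₀ c₁ hw hρ m hm U αU hα0 hα1 hU1 hreg εU hεU hUε hLb α hα hαD' hUst hUb hUη hpl hUgrad hRlev hεg hAQ hpos' hpos v
      (((WL2.equiv ℂ (fun _ : Bond d (towerP L m (n + 1)) => c₀) W)).symm g) F (fun y hy => by rw [Equiv.apply_symm_apply]; exact hgv y hy) (fun y => by rw [Equiv.apply_symm_apply]; exact hgF y) μ x).1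
  -- one summation over the source blocks each (volume-free row constants)
  have hV := norm_apply_le_of_local (fun y : Bond d (towerP L m (n + 1)) => blockCoord (L ^ (n + 1)) m (siteCast (towerP_eq_fineP_pow L m (n + 1)) (bpos y))) (fun x : Bond d (towerP L m (n + 1)) => blockCoord (L ^ (n + 1)) m (siteCast (towerP_eq_fineP_pow L m (n + 1)) (bpos x)))
    (tdist m) TV hBV hlocV (fun u => torusSum_le d hm hδV u) (WL2.equiv ℂ (fun _ : Bond d (towerP L m (n + 1)) => c₀) W f) hM0 hfM b
  have hD := norm_apply_le_of_local (fun y : Bond d (towerP L m (n + 1)) => blockCoord (L ^ (n + 1)) m (siteCast (towerP_eq_fineP_pow L m (n + 1)) (bpos y))) (fun x : Bond d (towerP L m (n + 1)) => blockCoord (L ^ (n + 1)) m (siteCast (towerP_eq_fineP_pow L m (n + 1)) (btgt x)))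
    (tdist m) TD hBD hlocD (fun u => torusSum_le d hm hδD u) (WL2.equiv ℂ (fun _ : Bond d (towerP L m (n + 1)) => c₀) W f) hM0 hfM b
  rw [hTV, Equiv.symm_apply_apply] at hV
  rw [hTD, Equiv.symm_apply_apply] at hD
  have h1 : BV * latticeConst d δV * M ≤ (BV * latticeConst d δV + BD * latticeConst d δD) * M :=
    mul_le_mul_of_nonneg_right (le_add_of_nonneg_right (mul_nonneg hBD hKD)) hM0
  have h2 : BD * latticeConst d δD * M ≤ (BV * latticeConst d δV + BD * latticeConst d δD) * M :=
    mul_le_mul_of_nonneg_right (le_add_of_nonneg_left (mul_nonneg hBV hKV)) hM0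
  exact ⟨hV.trans h1, hD.trans h2, norm_covGrad_apply_le_of_slice _ _ _ b μ (hD.trans h2)⟩

end Literature.MathematicalPhysics.QuantumFieldTheory.Balaban1983to89.B9Eq347G1kSupGradGlobal

end
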